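import Summits.FinalStateConjecture.FinalStateConjecture.Theses.DerivativeThrift
import Summits.FinalStateConjecture.FinalStateConjecture.Theorems.DerivativeThriftThriftyHandoffDefs
import Summits.FinalStateConjecture.FinalStateConjecture.Theorems.ClusterCompletenessAdiabaticMultiKerrILEDZoneKinematics
import Summits.FinalStateConjecture.FinalStateConjecture.Theorems.StarvedNecksNecksCertifyStubSeamSurgeryHelpers
import Summits.FinalStateConjecture.FinalStateConjecture.Theorems.NecksCertify.Negative.NecksCertifyFalseOfEqualVelocityBinaryWitness
import Literature.Geometry.Lorentzian.NearMinkowskiChartLateChart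
import HarnessLib

/-!
# Crux `ThriftyClusterSettling` (stmt-FinalStateConjecture-17611, route DerivativeThrift): the typed
# consequent FORCES outer-zone flatness (kernel form of the line-lead misstatement diagnosis)

Line `registered` of the crux (`Cruxes/ThriftyClusterSettling/Lines/registered.lean`, skeleton v3) composes
`stub_outerZoneFlatness → stub_thriftySeamedAtlas → stub_seamedAtlasSettles → ThriftyClusterSettling`, and
three successive line leads (c1, c2, c3) found the first stub fed by NO hypothesis of the crux (admissibility
of the datum, maximality, sojourn-complete `𝓘⁺`, `ThriftyKerrStability`, the thrifty hand-over all carry no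
late-time metric information on the cone complement `{|x̲| > (1 − θ) x⁰}`).  This file lands the converse
direction as a kernel fact: the crux's own CONSEQUENT — a `C²` final-state decomposition `d` of a region
`O ⊆ J⁺(ι X)` whose flat chart time is future-oriented — already CONTAINS an outer-zone flatness
certificate (`OuterFlatness` of the skeleton, stated here unfolded), for an aperture `θ > 0` determined by
the terminal velocities of the holes:

* `coneComplement_subset_flatDomain`: for every `FinalStateDecomposition d` there are `θ > 0` and
  `τₑ ≥ τ₀` with `{x⁰ > τₑ, |x̲| > (1 − θ) x⁰} ⊆ U₀` (the flat domain).  Kinematics: the rest-frame spatial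
  radius of a lab point `x` relative to hole `i` with motion `(Λᵢ, cᵢ)`, `uᵢ = Λᵢ e₀`, is at least
  `‖x̲ − c̲ᵢ‖ − |x⁰ − cᵢ⁰| · vᵢ` with `vᵢ = ‖ũᵢ‖/|uᵢ⁰| < 1` (`η`-invariance of `Λᵢ⁻¹`, imported from
  `Theorems/ClusterCompletenessAdiabaticMultiKerrILEDZoneKinematics.lean`), the Kerr–Schild radius satisfies
  `r ≥ ‖z̃‖ − |a|`, and the excision radii are sublinear (`d.tendsto_excision_div`); with
  `θ = (1 − maxᵢ vᵢ)/2` every point of the cone complement is eventually farther than `ρᵢ(x⁰)` from every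
  hole, hence in `U₀` (`d.setOf_lt_excision_subset_flatDomain`).
* `isLateChart_backgroundOn_of_le`: a late flat chart stays a late chart after any later time into any
  larger region (open-embedding restriction along `Topology.IsOpenEmbedding.inclusion`).
* `outerFlatness_of_decomposition`: the two facts above plus the decomposition's own radiation-zone
  clause `d.tendsto_deviationCk_flat` and the flat orientation clause give the outer-zone flatness
  certificate, witnessed by `(θ, τₑ, U₀, flatChart)`.
* `outerFlatness_of_settles`, `thriftyClusterSettling_forces_outerFlatness`: specialisations to the
  consequent of the crux and to the crux itself — GRANTED `ThriftyClusterSettling` and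
  `ThriftyKerrStability`, EVERY maximal development of admissible data with complete `𝓘⁺` and a thrifty
  hand-over (`Theorems.DerivativeThriftThriftyHandoff.FullHandoff`, verbatim the crux's antecedent) is
  outer-flat.  This is the precise sense in which the crux as filed asserts far-exterior late-time `C²`
  control that none of its hypotheses supplies (line dossiers `Lines/registered.md`,
  `Lines/registered-dead.md`, and this lead's `Lines/registered-dead-c3.md`); the companion negative
  lemma lives in `Theorems/ThriftyClusterSettling/Negative/`.

No analysis is claimed: everything is coordinate bookkeeping in `E4` (special relativity folklore,
O'Neill 1983, Ch. 9, pp. 233–236) over the chart vocabulary of `KerrConvergence.lean` (DHRT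
arXiv:2104.08222, §1) and the Kerr–Schild radius inequality `‖x̃‖² − a² ≤ r²` (Visser arXiv:0706.0622, (35)).
Line lead prover-line-stmt-FinalStateConjecture-17611-c3-0, 2026-08-17.
-/

noncomputable section

-- the doubled `FinalStateConjecture` path component is the summit/problem naming scheme
set_option linter.dupNamespace false

namespace Summit.FinalStateConjecture.FinalStateConjecture.Theorems.DerivativeThrift.ThriftyClusterSettling

open Set Filter Topology TopologicalSpace
open scoped Manifold ContDiff ENNReal InnerProductSpace
open Literature.Geometry.Lorentzian

universe u

/-! ## Kinematics of one boosted hole (coordinate bookkeeping in `E4`) -/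

/-- **Terminal speeds are subluminal.** For `Λ ∈ O(1,3)` the four-velocity `u = Λ e₀` has
`‖ũ‖ < |u⁰|` (`(u⁰)² = 1 + ‖ũ‖²`, O'Neill 1983, Ch. 9, p. 233). [folklore] -/
theorem spatialNorm_fourVelocity_lt_abs (Λ : lorentzGroup) :
    E4.spatialNorm ((Λ : E4 ≃L[ℝ] E4) (E4.basisVector 0)) <
      |((Λ : E4 ≃L[ℝ] E4) (E4.basisVector 0)) 0| := by
  have h := Theorems.lorentz_apply_zero_sq Λ
  refine lt_of_pow_lt_pow_left₀ 2 (abs_nonneg _) ?_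
  rw [sq_abs]
  linarith

/-- **Rest-frame distance from a moving hole, lower bound.** For a motion `(Λ, c)` with four-velocity
`u = Λ e₀` and lab speed `v = ‖ũ‖/|u⁰|`, the rest-frame spatial position `z̃` of the lab point `x`,
`z = Λ⁻¹(x − c)`, satisfies `‖x̲ − c̲‖ − |x⁰ − c⁰| v ≤ ‖z̃‖`: by `η`-invariance
`‖z̃‖² = ‖d‖² + ⟪ũ, d⟫²` with `d = (x̲ − c̲) − ((x⁰ − c⁰)/u⁰) ũ`
(`Cruxes.AdiabaticMultiKerrILED.Sketch.spatialNorm_sq_lorentz_symm`), and `‖d‖ ≥ ‖x̲ − c̲‖ − |x⁰ − c⁰| v`.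
O'Neill 1983, Ch. 9, pp. 233–236 (Lorentz contraction). [folklore] -/
theorem norm_sub_le_spatialNorm_poincareInv (Λ : lorentzGroup) (c x : E4) :
    ‖E4.spatial x - E4.spatial c‖ -
        |x 0 - c 0| * (E4.spatialNorm ((Λ : E4 ≃L[ℝ] E4) (E4.basisVector 0)) /
          |((Λ : E4 ≃L[ℝ] E4) (E4.basisVector 0)) 0|) ≤
      E4.spatialNorm (poincareInv Λ c x) := by
  set u : E4 := (Λ : E4 ≃L[ℝ] E4) (E4.basisVector 0) with hu
  have hγ : u 0 ≠ 0 := NecksCertify.Negative.lorentz_basisVector_zero_apply_zero_ne_zero Λ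
  set w : E4 := x - c with hw
  have hw0 : w 0 = x 0 - c 0 := by simp [hw]
  have hws : E4.spatial w = E4.spatial x - E4.spatial c := by rw [hw, map_sub]
  have hc' : w 0 = (w 0 / u 0) * u 0 := by field_simp
  have key := Cruxes.AdiabaticMultiKerrILED.Sketch.spatialNorm_sq_lorentz_symm Λ hu w (w 0 / u 0) hc'
  set dd : E3 := E4.spatial w - (w 0 / u 0) • E4.spatial u with hdd
  have hz : poincareInv Λ c x = (Λ : E4 ≃L[ℝ] E4).symm w := rfl
  -- `‖d‖ ≤ ‖z̃‖`
  have h1 : ‖dd‖ ≤ E4.spatialNorm (poincareInv Λ c x) := by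
    rw [hz]
    refine (pow_le_pow_iff_left₀ (norm_nonneg _) (E4.spatialNorm_nonneg _) two_ne_zero).1 ?_
    rw [key]
    nlinarith [sq_nonneg ⟪E4.spatial u, dd⟫_ℝ]
  -- `‖x̲ − c̲‖ − |x⁰ − c⁰| v ≤ ‖d‖`
  have h2 : ‖E4.spatial w‖ - ‖(w 0 / u 0) • E4.spatial u‖ ≤ ‖dd‖ := norm_sub_norm_le _ _
  have h3 : ‖(w 0 / u 0) • E4.spatial u‖ = |w 0| * (E4.spatialNorm u / |u 0|) := by
    rw [norm_smul, Real.norm_eq_abs, abs_div, E4.spatialNorm]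
    ring
  rw [h3, hws, hw0] at h2
  exact h2.trans h1

/-! ## The cone complement lies in the flat domain of every final-state decomposition -/

section Decomposition

variable {𝓢 : Spacetime.{u} 4} {O : Set 𝓢.carrier} {k : ℕ}

/-- **The late cone complement is charted by the flat chart.**  For every `N`-hole final-state
decomposition `d` there are an aperture `θ > 0` and a time `τₑ ≥ τ₀` such that every lab point `x` with
`x⁰ > τₑ` and `|x̲| > (1 − θ) x⁰` lies in the flat domain `U₀`.  With `vᵢ = ‖ũᵢ‖/|uᵢ⁰| < 1` the
terminal speeds and `θ = (1 − maxᵢ vᵢ)/2`, the rest-frame radius of such an `x` relative to hole `i` is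
`≥ θ x⁰ − ‖c̲ᵢ‖ − |cᵢ⁰| − |aᵢ|` (`norm_sub_le_spatialNorm_poincareInv`, `NecksCertifyBargmann.Seam.spatialNorm_le_kerr_radius_add_abs`),
which eventually exceeds the sublinear excision radius `ρᵢ(x⁰)` (`d.tendsto_excision_div`); then
`d.setOf_lt_excision_subset_flatDomain` applies.  O'Neill 1983, Ch. 9, pp. 233–236; DHRT arXiv:2104.08222,
§1 (chart vocabulary). [folklore] -/
theorem coneComplement_subset_flatDomain (d : FinalStateDecomposition 𝓢 O k) :
    ∃ θ τₑ : ℝ, 0 < θ ∧ d.τ₀ ≤ τₑ ∧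
      {x : E4 | τₑ < x 0 ∧ (1 - θ) * x 0 < E4.spatialNorm x} ⊆ (d.flatDomain : Set E4) := by
  -- terminal four-velocities and speeds
  set u : Fin d.N → E4 := fun i ↦ ((d.motion i).1 : E4 ≃L[ℝ] E4) (E4.basisVector 0) with hu
  set v : Fin d.N → ℝ := fun i ↦ E4.spatialNorm (u i) / |u i 0| with hv
  have hv0 : ∀ i, 0 ≤ v i := fun i ↦ div_nonneg (E4.spatialNorm_nonneg _) (abs_nonneg _)
  have hv1 : ∀ i, v i < 1 := fun i ↦
    (div_lt_one (abs_pos.2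
      (NecksCertify.Negative.lorentz_basisVector_zero_apply_zero_ne_zero (d.motion i).1))).2
      (spatialNorm_fourVelocity_lt_abs (d.motion i).1)
  -- the largest speed `b < 1` and the aperture `θ = (1 - b)/2`
  set b : ℝ := Finset.univ.fold max 0 v with hb
  have hb1 : b < 1 := (Finset.fold_max_lt (1 : ℝ)).2 ⟨one_pos, fun i _ ↦ hv1 i⟩
  have hvb : ∀ i, v i ≤ b := fun i ↦ (Finset.le_fold_max (v i)).2 (Or.inr ⟨i, Finset.mem_univ i, le_rfl⟩)
  set θ : ℝ := (1 - b) / 2 with hθ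
  have hθ0 : 0 < θ := by rw [hθ]; linarith
  -- per-hole constants and the eventual inequality `ρᵢ(t) + Cᵢ < θ t`
  set C : Fin d.N → ℝ := fun i ↦
    ‖E4.spatial (d.motion i).2‖ + |(d.motion i).2 0| + |d.spin i| with hC
  have hE : ∀ i, ∀ᶠ t in atTop, d.excision i t + C i < θ * t := by
    intro i
    have h1 : ∀ᶠ t in atTop, d.excision i t ≤ θ / 2 * t := by
      filter_upwards [(d.tendsto_excision_div i).eventually (gt_mem_nhds (half_pos hθ0)),
        eventually_gt_atTop (0 : ℝ)] with t ht ht0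
      have := (div_lt_iff₀ ht0).1 ht
      linarith
    have h2 : ∀ᶠ t in atTop, C i < θ / 2 * t :=
      (tendsto_id.const_mul_atTop (half_pos hθ0)).eventually_gt_atTop (C i)
    filter_upwards [h1, h2] with t h1 h2
    linarith
  obtain ⟨T, hT⟩ := eventually_atTop.1 ((eventually_all.2 hE).and (eventually_ge_atTop (0 : ℝ)))
  refine ⟨θ, max T d.τ₀, hθ0, le_max_right _ _, ?_⟩
  rintro x ⟨hxT, hxcone⟩
  have hx0T : T ≤ x 0 := (le_max_left _ _).trans hxT.le
  obtain ⟨hgood, hx0⟩ := hT (x 0) hx0T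
  refine d.setOf_lt_excision_subset_flatDomain ⟨(le_max_right _ _).trans_lt hxT, fun i ↦ ?_⟩
  -- hole `i`: rest-frame radius versus excision radius
  have hk := norm_sub_le_spatialNorm_poincareInv (d.motion i).1 (d.motion i).2 x
  have hr := NecksCertifyBargmann.Seam.spatialNorm_le_kerr_radius_add_abs (d.spin i)
    (poincareInv (d.motion i).1 (d.motion i).2 x)
  have hxc : ‖E4.spatial x‖ - ‖E4.spatial (d.motion i).2‖ ≤
      ‖E4.spatial x - E4.spatial (d.motion i).2‖ := norm_sub_norm_le _ _
  have habs : |x 0 - (d.motion i).2 0| ≤ x 0 + |(d.motion i).2 0| := by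
    calc |x 0 - (d.motion i).2 0| ≤ |x 0| + |(d.motion i).2 0| := abs_sub _ _
      _ = x 0 + |(d.motion i).2 0| := by rw [abs_of_nonneg hx0]
  have hp : |x 0 - (d.motion i).2 0| * v i ≤ x 0 * b + |(d.motion i).2 0| := by
    calc |x 0 - (d.motion i).2 0| * v i ≤ (x 0 + |(d.motion i).2 0|) * v i :=
          mul_le_mul_of_nonneg_right habs (hv0 i)
      _ = x 0 * v i + |(d.motion i).2 0| * v i := by ring
      _ ≤ x 0 * b + |(d.motion i).2 0| * 1 :=
          add_le_add (mul_le_mul_of_nonneg_left (hvb i) hx0)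
            (mul_le_mul_of_nonneg_left (hv1 i).le (abs_nonneg _))
      _ = x 0 * b + |(d.motion i).2 0| := by rw [mul_one]
  have hgi := hgood i
  have hsp : E4.spatialNorm x = ‖E4.spatial x‖ := rfl
  have hvi : E4.spatialNorm (u i) / |u i 0| = v i := rfl
  rw [hvi] at hk
  rw [hsp] at hxcone
  -- `ρᵢ(x⁰) < θ x⁰ - Cᵢ ≤ r`
  have hCi : C i = ‖E4.spatial (d.motion i).2‖ + |(d.motion i).2 0| + |d.spin i| := rfl
  rw [hCi] at hgi
  rw [hθ] at hgi hxcone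
  linarith [hk, hr, hxc, hp, hgi, hxcone, abs_nonneg (d.spin i)]

/-- **A late flat chart re-based to a later time and a larger region.**  If `Ψ : V → 𝓢` is a late chart
over the Minkowski background on `V` into `S` after `τ₀`, then for `τ₀ ≤ τ₁` and `S ⊆ S'` it is a late chart
into `S'` after `τ₁`: smoothness is unchanged, the open embedding of `{x⁰ > τ₀}` restricts to the open
subset `{x⁰ > τ₁}` (`Topology.IsOpenEmbedding.inclusion`), and the image condition is monotone.
DHRT arXiv:2104.08222, §1. [folklore] -/
theorem isLateChart_backgroundOn_of_le {V : Opens E4} {S S' : Set 𝓢.carrier} {τ₀ τ₁ : ℝ}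
    {Ψ : V → 𝓢.carrier} (h : 𝓢.IsLateChart (Minkowski.backgroundOn V) S τ₀ Ψ) (hτ : τ₀ ≤ τ₁)
    (hS : S ⊆ S') : 𝓢.IsLateChart (Minkowski.backgroundOn V) S' τ₁ Ψ where
  contMDiff := h.contMDiff
  isOpenEmbedding := by
    have hsub : (Minkowski.backgroundOn V).lateRegion τ₁ ⊆ (Minkowski.backgroundOn V).lateRegion τ₀ :=
      (Minkowski.backgroundOn V).lateRegion_mono hτ
    have hopen : IsOpen (Subtype.val ⁻¹' (Minkowski.backgroundOn V).lateRegion τ₁ :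
        Set ((Minkowski.backgroundOn V).lateRegion τ₀)) :=
      (Minkowski.isOpen_lateRegion_backgroundOn V τ₁).preimage continuous_subtype_val
    exact h.isOpenEmbedding.comp (Topology.IsOpenEmbedding.inclusion hsub hopen)
  image_subset :=
    (Set.image_mono ((Minkowski.backgroundOn V).lateRegion_mono hτ)).trans (h.image_subset.trans hS)

/-- **The consequent's decomposition carries an outer-zone flatness certificate.**  For every `Cᵏ`
final-state decomposition `d` of a region `O ⊆ S` whose flat chart pushes `∂₀` forward future-directed on
late flat slabs, there are `θ > 0`, `τₑ`, an open `V ⊇ {x⁰ > τₑ, |x̲| > (1 − θ) x⁰}` and a late chart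
`Φₑ : V → 𝓢` into `S` after `τₑ` over the Minkowski background on `V`, with full-slab `Cᵏ` deviation from
`η` tending to `0` and `∂₀` eventually pushed forward future-directed — namely `V = U₀`, `Φₑ` the flat chart
(`coneComplement_subset_flatDomain`, `isLateChart_backgroundOn_of_le`, `d.tendsto_deviationCk_flat`).
DHRT arXiv:2104.08222, §1; O'Neill 1983, Ch. 9. [folklore] -/
theorem outerFlatness_of_decomposition (d : FinalStateDecomposition 𝓢 O k) {S : Set 𝓢.carrier}
    (hOS : O ⊆ S)
    (hfut : ∀ᶠ τ in atTop, ∀ x ∈ (Minkowski.backgroundOn d.flatDomain).timeSlab τ,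
      𝓢.timeOrientation.IsFutureDirected (mfderiv 𝓘(ℝ, E4) (𝓡 4) d.flatChart x (E4.basisVector 0))) :
    ∃ (θ τₑ : ℝ) (V : Opens E4) (Φₑ : V → 𝓢.carrier), 0 < θ ∧
      {x : E4 | τₑ < x 0 ∧ (1 - θ) * x 0 < E4.spatialNorm x} ⊆ (V : Set E4) ∧
      𝓢.IsLateChart (Minkowski.backgroundOn V) S τₑ Φₑ ∧
      Tendsto (fun τ ↦ 𝓢.deviationCk (Minkowski.backgroundOn V) Φₑ k τ) atTop (𝓝 0) ∧
      ∀ᶠ τ in atTop, ∀ x ∈ (Minkowski.backgroundOn V).timeSlab τ,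
        𝓢.timeOrientation.IsFutureDirected (mfderiv 𝓘(ℝ, E4) (𝓡 4) Φₑ x (E4.basisVector 0)) := by
  obtain ⟨θ, τₑ, hθ, hτ, hsub⟩ := coneComplement_subset_flatDomain d
  exact ⟨θ, τₑ, d.flatDomain, d.flatChart, hθ, hsub,
    isLateChart_backgroundOn_of_le d.isLateChart_flat hτ hOS, d.tendsto_deviationCk_flat, hfut⟩

end Decomposition

/-! ## Specialisation to the crux -/

section Crux

variable {X : Type} [TopologicalSpace X] [ChartedSpace E3 X] [IsManifold (𝓡 3) ∞ X] [ConnectedSpace X]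
  {D : InitialDataSet (𝓡 3) X}

/-- **"Settles in the re-typed sense" implies outer-zone flatness.**  If the MGHD `𝒟` carries a region
`O` and a `C²` final-state decomposition `d` with sub-extremal holes, `O = exteriorOf 𝒟 d.charted`,
`HasExhaustiveCharts d` and `IsFutureOriented d` — verbatim the consequent of
`Theses.DerivativeThrift.ThriftyClusterSettling` — then `𝒟` is outer-flat: for some `θ > 0` a late flat
chart on an open `V ⊇ {x⁰ > τₑ, |x̲| > (1 − θ) x⁰}` into `J⁺(ι X)` has full-slab `C²` deviation `→ 0` and
`∂₀` eventually future-directed (the skeleton's `OuterFlatness 𝒟`, unfolded).  Only `O ⊆ J⁺(ι X)` (from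
`exteriorOf`) and the flat clause of `IsFutureOriented` are used.  DHRT arXiv:2104.08222, §1. [folklore] -/
theorem outerFlatness_of_settles (𝒟 : VacuumCauchyDevelopment D)
    (h : ∃ (O : Set 𝒟.carrier) (d : FinalStateDecomposition 𝒟.toSpacetime O 2),
      (∀ i, Kerr.IsSubextremal (d.mass i) (d.spin i)) ∧
        O = exteriorOf 𝒟.toCauchyDevelopment d.charted ∧ HasExhaustiveCharts d ∧ IsFutureOriented d) :
    ∃ (θ τₑ : ℝ) (V : Opens E4) (Φₑ : V → 𝒟.carrier), 0 < θ ∧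
      {x : E4 | τₑ < x 0 ∧ (1 - θ) * x 0 < E4.spatialNorm x} ⊆ (V : Set E4) ∧
      𝒟.toSpacetime.IsLateChart (Minkowski.backgroundOn V)
        (𝒟.metric.causalFuture 𝒟.timeOrientation (Set.range 𝒟.embed)) τₑ Φₑ ∧
      Tendsto (fun τ ↦ 𝒟.toSpacetime.deviationCk (Minkowski.backgroundOn V) Φₑ 2 τ) atTop (𝓝 0) ∧
      ∀ᶠ τ in atTop, ∀ x ∈ (Minkowski.backgroundOn V).timeSlab τ,
        𝒟.timeOrientation.IsFutureDirected (mfderiv 𝓘(ℝ, E4) (𝓡 4) Φₑ x (E4.basisVector 0)) := by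
  obtain ⟨O, d, -, hO, -, hfo⟩ := h
  have hOS : O ⊆ 𝒟.metric.causalFuture 𝒟.timeOrientation (Set.range 𝒟.embed) := by
    rw [hO]
    exact inter_subset_left
  exact outerFlatness_of_decomposition d hOS hfo.2.2

/-- **The crux as filed forces outer-zone flatness of every thrifty MGHD.**  Granted
`ThriftyClusterSettling` and its own hypothesis `ThriftyKerrStability`: for every admissible datum, every
maximal development with complete `𝓘⁺` and a thrifty `N`-hole hand-over
(`Theorems.DerivativeThriftThriftyHandoff.FullHandoff`, verbatim the crux's antecedent) is outer-flat.
The hand-over, maximality, sojourn-complete `𝓘⁺` and `ThriftyKerrStability` only speak about near zones in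
`J⁺` of hyperboloidal layers; the far-exterior late-time `C²` control concluded here is therefore content of
the crux beyond its hypotheses (line dossiers of `Cruxes/ThriftyClusterSettling/Lines/`).
DHRT arXiv:2104.08222, §1. [folklore] -/
theorem thriftyClusterSettling_forces_outerFlatness : Theses.DerivativeThrift.ThriftyClusterSettling → Theses.DerivativeThrift.ThriftyKerrStability → ∀ (X : Type) [TopologicalSpace X] [ChartedSpace E3 X] [IsManifold (𝓡 3) ∞ X] [T2Space X] [SecondCountableTopology X] [ConnectedSpace X] (D : InitialDataSet (𝓡 3) X), D ∈ admissibleVacuumData X → ∀ 𝒟 : VacuumCauchyDevelopment D, 𝒟.IsMaximal → HasCompleteNullInfinity 𝒟.toCauchyDevelopment → Theorems.DerivativeThriftThriftyHandoff.FullHandoff 𝒟 → ∃ (θ τₑ : ℝ) (V : Opens E4) (Φₑ : V → 𝒟.carrier), 0 < θ ∧ {x : E4 | τₑ < x 0 ∧ (1 - θ) * x 0 < E4.spatialNorm x} ⊆ (V : Set E4) ∧ 𝒟.toSpacetime.IsLateChart (Minkowski.backgroundOn V) (𝒟.metric.causalFuture 𝒟.timeOrientation (Set.range 𝒟.embed))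 τₑ Φₑ ∧ Tendsto (fun τ ↦ 𝒟.toSpacetime.deviationCk (Minkowski.backgroundOn V) Φₑ 2 τ) atTop (𝓝 0) ∧ ∀ᶠ τ in atTop, ∀ x ∈ (Minkowski.backgroundOn V).timeSlab τ, 𝒟.timeOrientation.IsFutureDirected (mfderiv 𝓘(ℝ, E4) (𝓡 4) Φₑ x (E4.basisVector 0)) := by
  intro h hK X _ _ _ _ _ _ D hD 𝒟 h𝒟 h𝓘 hF
  exact outerFlatness_of_settles 𝒟 (h hK X D hD 𝒟 h𝒟 h𝓘 hF)

end Crux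

end Summit.FinalStateConjecture.FinalStateConjecture.Theorems.DerivativeThrift.ThriftyClusterSettling

end
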